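import Literature.NumberTheory.Kottwitz1992.ModuliProblemHolds
import Literature.AlgebraicGeometry.ModuliOfAbelianVarieties.Lan2013.Sec121RealStructureFirstKindHolds
import Literature.RingTheory.CentralSimple.DoubleCentralizer
import Literature.RingTheory.CentralSimple.BrauerGroupReal
import Literature.RingTheory.CentralSimple.CentralizerCornerDimensions
import Literature.Algebra.Module.EndScalarExtension                    -- ★ Lam (7.4): `thetaAlgEquiv : ℝ ⊗_ℚ End_B(V) ≃ End_{B_ℝ}(V_ℝ)`
import Mathlib.RingTheory.MatrixAlgebra
import Mathlib.Data.Matrix.Composition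
import Mathlib.RingTheory.SimpleRing.Field
import Mathlib.FieldTheory.IsAlgClosed.Basic
import Mathlib.Algebra.Module.LinearMap.Rat
import Mathlib.LinearAlgebra.Matrix.ToLin
import HarnessLib

/-!
# [Kottwitz1992, §5 p. 391 (5.h)] «in Case C the algebra `C_ℝ` is a product of `[F₀ : ℚ]` copies of `M_{2n}(ℝ)`» — DISCHARGED:
# `Kottwitz1992_5_CR_caseC_holds`

Kernel-lane companion of the statement carpet ★ `Literature/NumberTheory/Kottwitz1992/ModuliProblem.lean` (squad TK; precedents ★
`ModuliProblemHolds`, ★ `ModuliProblemCasesHolds`, ★ `ModuliProblemMEvenHolds`, ★ `ModuliProblemCRCaseAHolds`, ★ `ModuliProblemCRCaseDHolds`):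
the named fact ★ `ModuliProblem.Kottwitz1992_5_CR_caseC` — for the rational PEL datum `(B, *, V, ⟨·,·⟩, h)` of §5 in Case C (`*` of the
first kind and of orthogonal type on `B`) the commutant `C = End_B(V)` satisfies `dim_ℚ C = (2n)² [F : ℚ]` and
`C_ℝ = ℝ ⊗_ℚ C ≃ₐ[ℝ] ∏_{[F₀ : ℚ]} M_{2n}(ℝ)` for some `n ≥ 1` — is PROVED here as `theorem Kottwitz1992_5_CR_caseC_holds : Kottwitz1992_5_CR_caseC`.
This file declares theorems only and introduces no new named fact; cell hodgecm-mathlib, seat B-typ04 (g32); net debt −1.  HC_CM is proved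
only modulo the 7 printed citations (2 remaining named inputs: hLiu418 = stmt-HodgeConjecture-24832, h413 = stmt-HodgeConjecture-24833) until
rung 0 closes; this file discharges none of them.

R. E. Kottwitz, *Points on some Shimura varieties over finite fields*, J. Amer. Math. Soc. 5 (1992), §5 p. 391 L33–L43 (held
`paper:doi-10-2307-2152772`, p0019).  THE PRINT: «The existence of `h : ℂ → C_ℝ` forces `m` to be even. […] Using that `*` is a positive
involution and that our form `⟨·,·⟩` is skew-Hermitian, one sees easily that in Case C the algebra `C_ℝ` is a product of `[F₀ : ℚ]` copies
of `M_{2n}(ℝ)`».  No proof is printed; THE PROOF GIVEN HERE (standard, parallel to ★ `ModuliProblemCRCaseDHolds`): §1 the centre `F = Z(B)`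
is a field, read on a `Type`-small copy `K ⊆ ℂ`; `B` is central simple over `K`, `*` is a positive involution of the first kind, so `K`
is totally real and, `*` being of orthogonal type (`2 dim Sym = [F:ℚ] d(d+1)`, i.e. `dim_K Sym(B, *) = C(d+1, 2)`), at every real embedding
`σ` one has `B_σ = ℝ ⊗_{K,σ} B ≅ M_d(ℝ)` — the tree's per-place engine ★ `Lan2013.Sec121PELLattices.exists_realModels_of_firstKind`
(Lange, Thm. 2.6.5 Steps II, V with Lemma 2.6.3, general degree); §2 `C` is central simple over `K` (★ `isSimpleRing_C`, ★ `center_C_map_val`),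
so `C_σ ≅ M_a(ℝ)` or `M_b(ℍ)` (★ `BrauerGroupReal.exists_algEquiv_matrix_real_or_quaternion`); §3 `V` is a `K`-vector space of dimension
`N` on which `B` and `C` act by commuting `K`-linear maps with `[B:K][C:K] = N²` (★ `finrank_mul_finrank_centralizer_range`), so
`B_σ ⊗_ℝ C_σ → M_N(ℝ)` is injective (★ `IsSimpleRing.tensorProduct_of_isCentral`) and bijective, and `C_σ ≅ M_b(ℍ)` would give
`M_N(ℝ) ≅ M_d(ℝ) ⊗ M_b(ℍ) ≅ M_{db}(ℍ)`, excluded by ★ `BrauerGroupReal.isEmpty_matrix_real_algEquiv_matrix_quaternion`; so `C_σ ≅ M_a(ℝ)`,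
`a² = [C:K]`, at every `σ`, and the real models glue (★ `exists_algEquiv_pi_of_realModels`) to `Φ : ℝ ⊗_ℚ C ≃ₐ[ℝ] ∏_{w ∣ ∞} M_a(ℝ)`;
§4 **`a` is even** («the existence of `h` forces `m` to be even»): `h(i)` is an `ℝ`-linear endomorphism of `V_ℝ = ℝ ⊗_ℚ V` of square
`−1` commuting with `B`, i.e. an element of `End_{B_ℝ}(V_ℝ)`, which is `ℝ ⊗_ℚ End_B(V) = ℝ ⊗_ℚ C` by Lam's Lemma (7.4) (the tree's ★
`Literature.Algebra.Module.NoetherDeuring.thetaAlgEquiv`); its image `J` under `Φ` in any factor `M_a(ℝ)` has `J² = −1`, so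
`det(L_J)² = (−1)^{a²}` forces `a` even, `a = 2n`; §5 reindex the places by `Fin [F₀ : ℚ]` (`[K:ℚ] = [F₀:ℚ]` infinite places, `K` totally
real).

## References
* [Kottwitz1992] R. E. Kottwitz, Points on some Shimura varieties over finite fields, J. Amer. Math. Soc. 5 (1992) 373–444, §5 p. 391.
* [Lange2023AbelianVarietiesComplex] H. Lange, Abelian Varieties over the Complex Numbers, Springer (2023), §2.6.2 (the per-place engine).
* [Lam2001FirstCourse] T. Y. Lam, A First Course in Noncommutative Rings, GTM 131, §7 Lemma (7.4) (the tree's `EndScalarExtension`).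
* [Voight2021] J. Voight, Quaternion Algebras, GTM 288 (2021), §7.7 Prop. 7.7.8 (double centralizer; the tree's `DoubleCentralizer`).
* [BourbakiAlgebreVIII2012] N. Bourbaki, Algèbre VIII (2012), §15 n°4 (`Br(ℝ)`; the tree's `BrauerGroupReal`).
-/
noncomputable section

open scoped TensorProduct Quaternion
open Module
open NumberField

namespace Literature.NumberTheory.Kottwitz1992.ModuliProblem

open Literature.RingTheory.CentralSimple
open Literature.NumberTheory.Kottwitz1992.ModuliProblemHolds
open Literature.AlgebraicGeometry.ModuliOfAbelianVarieties.Lan2013.Sec121PELLattices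
  (exists_realModels_of_firstKind isRealModel_map_algEquiv isRealModel_includeRight_baseChange)

universe u v

/-! ## §1 Real models as isomorphisms `ℝ ⊗_{K,σ} F ≅ A`; the Brauer obstruction `M_N(ℝ) ≄ M_n(ℍ) ⊗ M_a(ℝ)` -/

section RealModelEquiv

variable {K : Type} [Field K] [Algebra K ℝ] {F : Type u} [Ring F] [Algebra ℚ F] [Algebra K F]
  {A : Type*} [Ring A] [Algebra ℚ A] [Algebra ℝ A] [Algebra K A] [IsScalarTower K ℝ A]

/-- **A real model is an isomorphism `ℝ ⊗_{K,σ} F ⥲ A` in coordinates**: for a real model `j : F → A` at `σ = algebraMap K ℝ`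
the `ℝ`-algebra map `r ⊗ x ↦ r · j(x)` is an isomorphism (onto since `j(F)` spans, injective by `dim_ℝ A = [F : K]`).
[cite: Lange2023AbelianVarietiesComplex, §2.6.2 Thm. 2.6.5 proof Step II (PDF p0142 L18–L21)] -/
private theorem exists_algEquiv_of_isRealModel [Module.Finite K F] [FiniteDimensional ℝ A] {j : F →ₐ[ℚ] A}
    (hj : IsRealModel K (algebraMap K ℝ) j) :
    ∃ Φ : ℝ ⊗[K] F ≃ₐ[ℝ] A, ∀ (r : ℝ) (x : F), Φ (r ⊗ₜ[K] x) = r • j x := by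
  let j' : F →ₐ[K] A :=
    { toRingHom := j.toRingHom
      commutes' := fun k => by
        change j (algebraMap K F k) = algebraMap K A k
        rw [hj.map_algebraMap, IsScalarTower.algebraMap_apply K ℝ A] }
  have hj' : ∀ x, j' x = j x := fun _ => rfl
  let Φ₀ : ℝ ⊗[K] F →ₐ[ℝ] A :=
    Algebra.TensorProduct.lift (Algebra.ofId ℝ A) j' fun r x => Algebra.commutes r (j' x)
  have hΦ₀ : ∀ (r : ℝ) (x : F), Φ₀ (r ⊗ₜ[K] x) = r • j x := fun r x => by
    rw [Algebra.TensorProduct.lift_tmul, Algebra.ofId_apply, hj', ← Algebra.smul_def]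
  have hrange : LinearMap.range Φ₀.toLinearMap = ⊤ := by
    rw [eq_top_iff, ← hj.span_range, Submodule.span_le]
    rintro _ ⟨x, rfl⟩
    exact ⟨(1 : ℝ) ⊗ₜ[K] x, by rw [AlgHom.toLinearMap_apply, hΦ₀, one_smul]⟩
  have hsurj : Function.Surjective Φ₀ := fun y => by
    obtain ⟨x, hx⟩ := LinearMap.range_eq_top.mp hrange y
    exact ⟨x, hx⟩
  have hdim : finrank ℝ (ℝ ⊗[K] F) = finrank ℝ A := by rw [Module.finrank_baseChange, hj.finrank_eq]
  have hinj : Function.Injective Φ₀ :=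
    (LinearMap.injective_iff_surjective_of_finrank_eq_finrank hdim (f := Φ₀.toLinearMap)).mpr hsurj
  exact ⟨AlgEquiv.ofBijective Φ₀ ⟨hinj, hsurj⟩, fun r x => by rw [AlgEquiv.ofBijective_apply]; exact hΦ₀ r x⟩

end RealModelEquiv

/-- **`[ℝ] ≠ [ℍ]` in tensor form**: an `ℝ`-algebra `X ⊗_ℝ Y` with `X ≅ M_d(ℝ)` and `Y ≅ M_b(ℍ)` (`d, b ≥ 1`) is `≅ M_{db}(ℍ)`, hence
not isomorphic to any `M_N(ℝ)`. [cite: BourbakiAlgebreVIII2012, VIII §15 n°4 (p. A VIII.278)] -/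
private theorem false_of_algEquiv_tensor_real_quaternion {X : Type*} {Y : Type*} [Ring X] [Algebra ℝ X] [Ring Y] [Algebra ℝ Y]
    {N d b : ℕ} [NeZero N] (hd : d ≠ 0) (hb : b ≠ 0) (e : X ⊗[ℝ] Y ≃ₐ[ℝ] Matrix (Fin N) (Fin N) ℝ)
    (φ : X ≃ₐ[ℝ] Matrix (Fin d) (Fin d) ℝ) (ψ : Y ≃ₐ[ℝ] Matrix (Fin b) (Fin b) ℍ[ℝ]) : False := by
  haveI : NeZero (d * b) := ⟨mul_ne_zero hd hb⟩
  have E : Matrix (Fin N) (Fin N) ℝ ≃ₐ[ℝ] Matrix (Fin (d * b)) (Fin (d * b)) ℍ[ℝ] :=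
    e.symm.trans <| (Algebra.TensorProduct.congr φ ψ).trans <| (Algebra.TensorProduct.comm ℝ _ _).trans <|
      (matrixEquivTensor (Fin d) ℝ (Matrix (Fin b) (Fin b) ℍ[ℝ])).symm.trans <|
      (Matrix.compAlgEquiv (Fin d) (Fin b) ℍ[ℝ] ℝ).trans (Matrix.reindexAlgEquiv ℝ ℍ[ℝ] finProdFinEquiv)
  exact (BrauerGroupReal.isEmpty_matrix_real_algEquiv_matrix_quaternion N (d * b)).false E

/-- An element `J` with `J² = −1` in a finite-dimensional real algebra `D` forces `dim_ℝ D` to be even: `det(L_J)² = det(L_{−1}) =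
(−1)^{dim D}` (as in ★ `ModuliProblemMEvenHolds`). [folklore] -/
private theorem even_finrank_of_mul_self_eq_neg_one {D : Type*} [Ring D] [Algebra ℝ D] {J : D} (hJ : J * J = -1) :
    Even (finrank ℝ D) := by
  rcases Nat.even_or_odd (finrank ℝ D) with h | h
  · exact h
  · exfalso
    have h1 : LinearMap.mulLeft ℝ (-1 : D) = (-1 : ℝ) • (LinearMap.id : D →ₗ[ℝ] D) :=
      LinearMap.ext fun x => by rw [LinearMap.mulLeft_apply, neg_one_mul, LinearMap.smul_apply, LinearMap.id_apply, neg_one_smul]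
    have h2 : LinearMap.det (LinearMap.mulLeft ℝ J) * LinearMap.det (LinearMap.mulLeft ℝ J) = -1 := by
      rw [← map_mul, Module.End.mul_eq_comp, ← LinearMap.mulLeft_mul, hJ, h1, LinearMap.det_smul, LinearMap.det_id, mul_one,
        h.neg_one_pow]
    nlinarith [mul_self_nonneg (LinearMap.det (LinearMap.mulLeft ℝ J))]

/-! ## §2 One real place: `ℝ ⊗_{K,σ} C ≅ M_a(ℝ)` when `(B, *)` is of orthogonal type -/

section Place

variable {K : Type} [Field K] [NumberField K] [IsTotallyReal K] [Algebra K ℝ]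
  {B : Type u} [Ring B] [Algebra ℚ B] [Algebra K B] [IsScalarTower ℚ K B] [FiniteDimensional ℚ B]
  [Algebra.IsCentral K B] [IsSimpleRing B]
  {C : Type v} [Ring C] [Algebra ℚ C] [Algebra K C] [IsScalarTower ℚ K C] [FiniteDimensional ℚ C]
  [Algebra.IsCentral K C] [IsSimpleRing C]

/-- **The place-`σ` component of `C` in Case C.**  Let `B` (central simple over the totally real `K`, positive involution `* = ιK` of
the first kind and of orthogonal type, `dim_K Sym(B, *) = C(d+1, 2)`, `[B : K] = d²`) and `C` (central simple over `K`) map by `K`-algebra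
maps `β`, `γ` with commuting images into `M_N(K)`, `[B : K][C : K] = N²`.  Then at `σ = algebraMap K ℝ`: `B_σ ≅ M_d(ℝ)`
(★ `exists_realModels_of_firstKind`), `C_σ` is central simple over `ℝ`, `B_σ ⊗_ℝ C_σ → M_N(ℝ)` is injective (simplicity) hence bijective
(dimensions), so `C_σ ≅ M_b(ℍ)` would give `M_N(ℝ) ≅ M_d(ℝ) ⊗ M_b(ℍ) ≅ M_{db}(ℍ)`, impossible; hence `C_σ ≅ M_a(ℝ)` (`a² = [C : K]`), and
`c ↦ ψ(1 ⊗ c)` is a real model `C → M_a(ℝ)` at `σ` — «in Case C the algebra `C_ℝ` is a product of `[F₀ : ℚ]` copies of `M_{2n}(ℝ)`», one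
place at a time (the evenness of `a` is global, from `h`). [cite: Kottwitz1992, §5 (p. 391)] -/
private theorem exists_realModel_real_of_orthogonalType {ι : B →ₗ[ℚ] B} (hpos : IsPositiveAntiInvolution B ι)
    (ιK : B →ₗ[K] B) (hιK : ∀ x, ιK x = ι x) {d : ℕ} (hd : finrank K B = d * d) (hd0 : d ≠ 0)
    (hs : finrank K (symmSubmodule ιK) = (d + 1).choose 2)
    {N : ℕ} (βM : B →ₐ[K] Matrix (Fin N) (Fin N) K) (γM : C →ₐ[K] Matrix (Fin N) (Fin N) K)
    (hcomm : ∀ b c, βM b * γM c = γM c * βM b) (hdim : finrank K B * finrank K C = N * N) :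
    ∃ a : ℕ, a ≠ 0 ∧ finrank K C = a * a ∧
      ∃ j : C →ₐ[ℚ] Matrix (Fin a) (Fin a) ℝ, IsRealModel K (algebraMap K ℝ) j := by
  classical
  haveI : Module.Finite K B := Module.Finite.of_restrictScalars_finite ℚ K B
  haveI : Module.Finite K C := Module.Finite.of_restrictScalars_finite ℚ K C
  haveI : SMulCommClass K ℚ ℝ :=
    ⟨fun k q r => by rw [Algebra.smul_def, Algebra.smul_def, Algebra.smul_def, Algebra.smul_def]; ring⟩
  -- `B_σ ≅ M_d(ℝ)`
  obtain ⟨jB, hjB, -⟩ := (exists_realModels_of_firstKind hpos ιK hιK hd).1 hs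
  obtain ⟨φB, -⟩ := exists_algEquiv_of_isRealModel hjB
  -- `C_σ` and `B_σ` are central simple over `ℝ`
  haveI : IsSimpleRing (ℝ ⊗[K] C) := isSimpleRing_tensorProduct (K := K) (D := C) ℝ
  haveI : Algebra.IsCentral ℝ (ℝ ⊗[K] C) :=
    Literature.NumberTheory.Automorphic.BaseChange.isCentral_baseChange (K := K) (D := C) ℝ
  haveI : IsSimpleRing (ℝ ⊗[K] B) := isSimpleRing_tensorProduct (K := K) (D := B) ℝ
  haveI : Algebra.IsCentral ℝ (ℝ ⊗[K] B) :=
    Literature.NumberTheory.Automorphic.BaseChange.isCentral_baseChange (K := K) (D := B) ℝ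
  obtain ⟨b, hb, hC⟩ := BrauerGroupReal.exists_algEquiv_matrix_real_or_quaternion (ℝ ⊗[K] C)
  -- the commuting pair `B_σ → M_N(ℝ) ← C_σ`
  let σA : Matrix (Fin N) (Fin N) K →ₐ[K] Matrix (Fin N) (Fin N) ℝ := (Algebra.ofId K ℝ).mapMatrix
  let βR : B →ₐ[K] Matrix (Fin N) (Fin N) ℝ := σA.comp βM
  let γR : C →ₐ[K] Matrix (Fin N) (Fin N) ℝ := σA.comp γM
  have hcommR : ∀ x y, βR x * γR y = γR y * βR x := fun x y => by
    change σA (βM x) * σA (γM y) = σA (γM y) * σA (βM x)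
    rw [← map_mul, hcomm, map_mul]
  let ΘB : ℝ ⊗[K] B →ₐ[ℝ] Matrix (Fin N) (Fin N) ℝ :=
    Algebra.TensorProduct.lift (Algebra.ofId ℝ _) βR fun s x => Algebra.commutes s (βR x)
  let ΘC : ℝ ⊗[K] C →ₐ[ℝ] Matrix (Fin N) (Fin N) ℝ :=
    Algebra.TensorProduct.lift (Algebra.ofId ℝ _) γR fun s y => Algebra.commutes s (γR y)
  have hΘB : ∀ (s : ℝ) (x : B), ΘB (s ⊗ₜ[K] x) = s • βR x := fun s x => by
    rw [Algebra.TensorProduct.lift_tmul, Algebra.ofId_apply, ← Algebra.smul_def]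
  have hΘC : ∀ (s : ℝ) (y : C), ΘC (s ⊗ₜ[K] y) = s • γR y := fun s y => by
    rw [Algebra.TensorProduct.lift_tmul, Algebra.ofId_apply, ← Algebra.smul_def]
  have hΘcomm : ∀ x y, ΘB x * ΘC y = ΘC y * ΘB x := by
    intro x y
    induction x using TensorProduct.induction_on with
    | zero => rw [map_zero, zero_mul, mul_zero]
    | add x x' hx hx' => rw [map_add, add_mul, mul_add, hx, hx']
    | tmul s b =>
      induction y using TensorProduct.induction_on with
      | zero => rw [map_zero, zero_mul, mul_zero]
      | add y y' hy hy' => rw [map_add, add_mul, mul_add, hy, hy']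
      | tmul t c =>
        rw [hΘB, hΘC, smul_mul_smul_comm, smul_mul_smul_comm, hcommR, mul_comm s t]
  let Θ : (ℝ ⊗[K] B) ⊗[ℝ] (ℝ ⊗[K] C) →ₐ[ℝ] Matrix (Fin N) (Fin N) ℝ :=
    Algebra.TensorProduct.lift ΘB ΘC fun x y => hΘcomm x y
  haveI : IsSimpleRing ((ℝ ⊗[K] B) ⊗[ℝ] (ℝ ⊗[K] C)) :=
    Literature.NumberTheory.Automorphic.IsSimpleRing.tensorProduct_of_isCentral (K := ℝ) (A := ℝ ⊗[K] B) (B := ℝ ⊗[K] C)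
  have hN : N ≠ 0 := by
    intro h0
    rw [h0, mul_zero] at hdim
    rcases Nat.mul_eq_zero.mp hdim with h | h
    · exact (finrank_pos (R := K) (M := B)).ne' h
    · exact (finrank_pos (R := K) (M := C)).ne' h
  haveI : NeZero N := ⟨hN⟩
  have hinj : Function.Injective Θ := RingHom.injective Θ.toRingHom
  have hdimR : finrank ℝ ((ℝ ⊗[K] B) ⊗[ℝ] (ℝ ⊗[K] C)) = finrank ℝ (Matrix (Fin N) (Fin N) ℝ) := by
    rw [Module.finrank_tensorProduct, Module.finrank_baseChange, Module.finrank_baseChange, hdim, Module.finrank_matrix,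
      Fintype.card_fin, Module.finrank_self, mul_one]
  have hsurj : Function.Surjective Θ :=
    (LinearMap.injective_iff_surjective_of_finrank_eq_finrank hdimR (f := Θ.toLinearMap)).mp hinj
  let ΘE : (ℝ ⊗[K] B) ⊗[ℝ] (ℝ ⊗[K] C) ≃ₐ[ℝ] Matrix (Fin N) (Fin N) ℝ := AlgEquiv.ofBijective Θ ⟨hinj, hsurj⟩
  rcases hC with ⟨⟨ψ⟩⟩ | ⟨⟨ψ⟩⟩
  · refine ⟨b, hb, ?_, ⟨_, isRealModel_map_algEquiv isRealModel_includeRight_baseChange ψ⟩⟩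
    have h := ψ.toLinearEquiv.finrank_eq
    rw [Module.finrank_baseChange, Module.finrank_matrix, Fintype.card_fin, Module.finrank_self, mul_one] at h
    exact h
  · exact (false_of_algEquiv_tensor_real_quaternion hd0 hb ΘE φB ψ).elim

end Place


/-! ## §3 The discharge -/

/-- `2 · C(n+1, 2) = n (n+1)`. [folklore] -/
private theorem two_mul_choose_two_succ (n : ℕ) : 2 * (n + 1).choose 2 = n * (n + 1) := by
  have h := Nat.add_one_mul_choose_eq n 1
  rw [Nat.choose_one_right] at h
  rw [mul_comm 2, ← h, mul_comm]

/-- `End_ℚ(V) ≅ M_n(ℚ)` is a simple ring when `V ≠ 0` is finite-dimensional (private plumbing). [folklore] -/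
private theorem isSimpleRing_moduleEnd {V : Type v} [AddCommGroup V] [Module ℚ V] [FiniteDimensional ℚ V] [Nontrivial V] :
    IsSimpleRing (Module.End ℚ V) := by
  have hn : 0 < finrank ℚ V := finrank_pos
  haveI : Nonempty (Fin (finrank ℚ V)) := ⟨⟨0, hn⟩⟩
  exact IsSimpleRing.of_ringEquiv (LinearMap.toMatrixAlgEquiv (Module.finBasis ℚ V)).symm.toRingEquiv inferInstance

set_option maxHeartbeats 400000 in
/-- **(5.h), Case C, PROVED**: ★ `Kottwitz1992_5_CR_caseC` holds — for the rational PEL datum of §5 in Case C,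
`dim_ℚ C = (2n)² [F : ℚ]` and `ℝ ⊗_ℚ End_B(V) ≃ₐ[ℝ] ∏_{[F₀ : ℚ]} M_{2n}(ℝ)` for some `n ≥ 1` (module docstring for the proof).
[cite: Kottwitz1992, §5 (p. 391)] -/
theorem Kottwitz1992_5_CR_caseC_holds : Kottwitz1992_5_CR_caseC.{u, v} := by
  intro B _ _ _ _ V _ _ D hD
  haveI := D.isSimpleRing
  haveI := D.finiteDimensional
  haveI := D.finiteDimensionalV
  haveI := D.nontrivialV
  classical
  obtain ⟨hfix, d, hdimB, hSymC⟩ := hD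
  /- §1 the centre `F = Z(B)` is a field; a `Type`-small copy `K ⊆ ℂ` -/
  set Z : Subalgebra ℚ B := Subalgebra.center ℚ B with hZdef
  have hZ : IsField Z :=
    MulEquiv.isField (IsSimpleRing.isField_center B)
      ({ toFun := fun x => ⟨x.1, Subring.mem_center_iff.2 (Subalgebra.mem_center_iff.1 x.2)⟩
         invFun := fun x => ⟨x.1, Subalgebra.mem_center_iff.2 (Subring.mem_center_iff.1 x.2)⟩
         left_inv := fun _ => rfl
         right_inv := fun _ => rfl
         map_mul' := fun _ _ => rfl } : Z ≃* Subring.center B)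
  letI : Field Z := hZ.toField
  haveI : FiniteDimensional ℚ Z := Module.Finite.of_injective Z.val.toLinearMap Subtype.val_injective
  have hzpos : 0 < finrank ℚ Z := finrank_pos
  let φ : Z →+* ℂ := (IsAlgClosed.lift : Z →ₐ[ℚ] ℂ).toRingHom
  obtain ⟨K, _instK, _instCZ, ⟨e⟩⟩ : ∃ (K : Type) (_ : Field K) (_ : CharZero K), Nonempty (Z ≃+* K) :=
    ⟨↥φ.fieldRange, inferInstance, inferInstance, ⟨φ.rangeRestrictFieldEquiv⟩⟩
  let eQ : Z ≃ₐ[ℚ] K := AlgEquiv.ofRingEquiv (f := e) fun q => by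
    rw [eq_ratCast (algebraMap ℚ K) q, ← eq_ratCast (e.toRingHom.comp (algebraMap ℚ Z)) q]
    rfl
  haveI : FiniteDimensional ℚ K := LinearEquiv.finiteDimensional eQ.toLinearEquiv
  haveI : NumberField K := @NumberField.mk K _ inferInstance inferInstance
  have hKZ : finrank ℚ K = finrank ℚ Z := eQ.toLinearEquiv.finrank_eq.symm
  have hK0 : 0 < finrank ℚ K := by rw [hKZ]; exact hzpos
  /- §2 `B` is a finite central simple `K`-algebra through `K ≅ F ⊆ B` -/
  let ιB : K →+* B := (Z.val : Z →ₐ[ℚ] B).toRingHom.comp e.symm.toRingHom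
  have hιB : ∀ k : K, ιB k = ((e.symm k : Z) : B) := fun _ => rfl
  have hιB_mem : ∀ k : K, ιB k ∈ Z := fun k => (e.symm k).2
  have hιBc : ∀ (k : K) (b : B), ιB k * b = b * ιB k := fun k b => (Subalgebra.mem_center_iff.1 (hιB_mem k) b).symm
  letI : Algebra K B := ιB.toAlgebra' hιBc
  have halgB : ∀ k : K, algebraMap K B k = ιB k := fun _ => rfl
  haveI : IsScalarTower ℚ K B := ⟨fun q k b => by
    change ιB (q • k) * b = q • (ιB k * b)
    rw [map_rat_smul ιB q k, smul_mul_assoc]⟩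
  haveI : Module.Finite K B := Module.Finite.of_restrictScalars_finite ℚ K B
  haveI : Algebra.IsCentral K B := ⟨fun z hz => by
    have hz' : z ∈ Z := Subalgebra.mem_center_iff.2 (Subalgebra.mem_center_iff.1 hz)
    exact Algebra.mem_bot.2 ⟨e ⟨z, hz'⟩, by rw [halgB, hιB, e.symm_apply_apply]⟩⟩
  /- §3 `*` is a positive involution of the first kind; `K` is totally real; `*` is `K`-linear -/
  obtain ⟨ι, hι⟩ : ∃ ι : B →ₗ[ℚ] B, ∀ x, ι x = star x :=
    ⟨{ toFun := star
       map_add' := star_add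
       map_smul' := fun q x => by rw [RingHom.id_apply, star_smul, star_trivial] }, fun _ => rfl⟩
  have hpos : IsPositiveAntiInvolution B ι :=
    { map_mul := fun x y => by rw [hι, hι, hι, star_mul]
      apply_apply := fun x => by rw [hι, hι, star_star]
      trace_pos := fun x hx => by
        have hx' : star x ≠ 0 := fun h0 => hx (by rw [← star_star x, h0, star_zero])
        have h := D.pos (star x) hx'
        rw [star_star] at h
        have hl : LinearMap.mulLeft ℚ (star x * x) = Algebra.lmul ℚ B (star x * x) := LinearMap.ext fun _ => rfl
        rw [hι, Literature.NumberTheory.Automorphic.leftMulTrace_apply, ← hl]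
        exact h }
  have h1 : IsOfFirstKind K B ι := fun k => by
    rw [hι, halgB]
    exact hfix _ (hιB_mem k)
  haveI : IsTotallyReal K :=
    (hpos.forall_apply_algHom_eq_iff_isTotallyReal (IsScalarTower.toAlgHom ℚ K B) (τ := LinearMap.id)
      (fun x => by simpa using h1 x)).mp (fun x => by simpa using h1 x)
  obtain ⟨ιK, hιK⟩ : ∃ ιK : B →ₗ[K] B, ∀ x, ιK x = ι x :=
    ⟨{ toFun := ι
       map_add' := fun x y => map_add ι x y
       map_smul' := fun c x => by
         rw [RingHom.id_apply, Algebra.smul_def, Algebra.smul_def, hpos.map_mul, h1 c, Algebra.commutes] },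
      fun _ => rfl⟩
  /- §4 `[B : K] = d²` and `dim_K Sym(B, *) = C(d+1, 2)` (orthogonal type) -/
  have htowerB : finrank ℚ B = finrank ℚ K * finrank K B := (Module.finrank_mul_finrank ℚ K B).symm
  have hdK : finrank K B = d * d := by
    apply Nat.eq_of_mul_eq_mul_left hK0
    rw [← htowerB, hdimB, hKZ, pow_two, mul_comm]
  have hd0 : 0 < d := by
    rcases Nat.eq_zero_or_pos d with h0 | h0
    · exfalso
      rw [h0, mul_zero] at hdK
      exact (finrank_pos (R := K) (M := B)).ne' hdK
    · exact h0
  have hmem : ∀ x : B, x ∈ symmSubmodule ιK ↔ x ∈ selfAdjoint.submodule ℚ B := fun x => by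
    rw [mem_symmSubmodule_iff, hιK, hι]
    exact (selfAdjoint.mem_iff (x := x)).symm
  let eS : ↥(symmSubmodule ιK) ≃ₗ[ℚ] ↥(selfAdjoint.submodule ℚ B) :=
    { toFun := fun x => ⟨(x : B), (hmem x.1).mp x.2⟩
      invFun := fun x => ⟨(x : B), (hmem x.1).mpr x.2⟩
      map_add' := fun _ _ => rfl
      map_smul' := fun _ _ => rfl
      left_inv := fun _ => rfl
      right_inv := fun _ => rfl }
  have hsym : finrank ℚ (selfAdjoint.submodule ℚ B) = finrank ℚ K * finrank K (symmSubmodule ιK) := by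
    rw [← eS.finrank_eq, Module.finrank_mul_finrank]
  have hs : finrank K (symmSubmodule ιK) = (d + 1).choose 2 := by
    rw [hsym, ← hKZ, mul_comm 2, mul_assoc] at hSymC
    -- `[K:ℚ] (2 s) = [K:ℚ] d(d+1) = [K:ℚ] (2 C(d+1,2))`
    have h2 := Nat.eq_of_mul_eq_mul_left hK0 hSymC
    rw [← two_mul_choose_two_succ, mul_comm] at h2
    exact Nat.eq_of_mul_eq_mul_left two_pos h2
  /- §5 `C = End_B(V)` is a finite central simple `K`-algebra through `K ≅ F —ρ→ C` -/
  haveI : IsSimpleRing D.C := isSimpleRing_C D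
  let ιZ : Z →+* D.C :=
    { toFun := fun z => ⟨D.ρ (z : B), (rho_mem_C_iff D (z : B)).2 z.2⟩
      map_one' := Subtype.ext (by simp)
      map_mul' := fun a b => Subtype.ext (by simp)
      map_zero' := Subtype.ext (by simp)
      map_add' := fun a b => Subtype.ext (by simp) }
  let ιC : K →+* D.C := ιZ.comp e.symm.toRingHom
  have hιC : ∀ k : K, ((ιC k : D.C) : Module.End ℚ V) = D.ρ (ιB k) := fun _ => rfl
  have hιCc : ∀ (k : K) (c : D.C), ιC k * c = c * ιC k := fun k c => by
    apply Subtype.ext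
    have hc : (c : Module.End ℚ V) ∈ Subalgebra.centralizer ℚ (Set.range D.ρ) := c.2
    rw [Subalgebra.mem_centralizer_iff] at hc
    change (ιC k : Module.End ℚ V) * c = c * (ιC k : Module.End ℚ V)
    rw [hιC]
    exact hc _ ⟨_, rfl⟩
  letI : Algebra K D.C := ιC.toAlgebra' hιCc
  have halgC : ∀ k : K, algebraMap K D.C k = ιC k := fun _ => rfl
  haveI : IsScalarTower ℚ K D.C := ⟨fun q k c => by
    change ιC (q • k) * c = q • (ιC k * c)
    rw [map_rat_smul ιC q k, smul_mul_assoc]⟩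
  haveI : Module.Finite ℚ D.C := Module.Finite.of_injective D.C.val.toLinearMap Subtype.val_injective
  haveI : Module.Finite K D.C := Module.Finite.of_restrictScalars_finite ℚ K D.C
  haveI : Algebra.IsCentral K D.C := ⟨fun c hc => by
    rw [Subalgebra.mem_center_iff] at hc
    have hc' : (c : Module.End ℚ V) ∈ (Subalgebra.center ℚ D.C).map D.C.val :=
      Subalgebra.mem_map.2 ⟨c, Subalgebra.mem_center_iff.2 hc, rfl⟩
    rw [center_C_map_val D, Subalgebra.mem_map] at hc'
    obtain ⟨b, hb, hbc⟩ := hc'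
    refine Algebra.mem_bot.2 ⟨e ⟨b, hb⟩, Subtype.ext ?_⟩
    rw [halgC, hιC, hιB, e.symm_apply_apply, hbc]⟩
  /- §6 `V` as a `K`-vector space; `B` and `C` act by commuting `K`-linear maps; `[B:K][C:K] = N²` -/
  letI : Module K V := Module.compHom V ((D.ρ : B →+* Module.End ℚ V).comp ιB)
  have hsmulV : ∀ (k : K) (x : V), k • x = D.ρ (ιB k) x := fun _ _ => rfl
  haveI : IsScalarTower ℚ K V := ⟨fun q k x => by
    rw [hsmulV, hsmulV, map_rat_smul ιB q k, map_smul, LinearMap.smul_apply]⟩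
  haveI : Module.Finite K V := Module.Finite.of_restrictScalars_finite ℚ K V
  have hρK : ∀ (b : B) (k : K) (x : V), D.ρ b (k • x) = k • D.ρ b x := fun b k x => by
    rw [hsmulV, hsmulV, ← Module.End.mul_apply, ← map_mul, ← hιBc, map_mul, Module.End.mul_apply]
  have hcK : ∀ (c : D.C) (k : K) (x : V), (c : Module.End ℚ V) (k • x) = k • (c : Module.End ℚ V) x := fun c k x => by
    have hc := (Subalgebra.mem_centralizer_iff ℚ).1 c.2 (D.ρ (ιB k)) ⟨_, rfl⟩
    rw [hsmulV, hsmulV, ← Module.End.mul_apply, ← hc, Module.End.mul_apply]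
  let βE : B →ₐ[K] Module.End K V :=
    { toFun := fun b =>
        { toFun := fun x => D.ρ b x
          map_add' := fun x y => map_add _ x y
          map_smul' := fun k x => hρK b k x }
      map_one' := LinearMap.ext fun x => by simp
      map_mul' := fun a b => LinearMap.ext fun x => by simp
      map_zero' := LinearMap.ext fun x => by simp
      map_add' := fun a b => LinearMap.ext fun x => by simp
      commutes' := fun k => LinearMap.ext fun x => by
        rw [Module.algebraMap_end_apply, hsmulV, halgB]
        rfl }
  have hβE : ∀ (b : B) (x : V), βE b x = D.ρ b x := fun _ _ => rfl
  let γE : D.C →ₐ[K] Module.End K V :=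
    { toFun := fun c =>
        { toFun := fun x => (c : Module.End ℚ V) x
          map_add' := fun x y => map_add _ x y
          map_smul' := fun k x => hcK c k x }
      map_one' := LinearMap.ext fun x => rfl
      map_mul' := fun a b => LinearMap.ext fun x => rfl
      map_zero' := LinearMap.ext fun x => rfl
      map_add' := fun a b => LinearMap.ext fun x => rfl
      commutes' := fun k => LinearMap.ext fun x => by
        rw [Module.algebraMap_end_apply, hsmulV, halgC]
        rfl }
  have hγE : ∀ (c : D.C) (x : V), γE c x = (c : Module.End ℚ V) x := fun _ _ => rfl
  have hcommE : ∀ (b : B) (c : D.C), βE b * γE c = γE c * βE b := fun b c => by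
    apply LinearMap.ext
    intro x
    have hc := (Subalgebra.mem_centralizer_iff ℚ).1 c.2 (D.ρ b) ⟨_, rfl⟩
    rw [Module.End.mul_apply, Module.End.mul_apply, hβE, hγE, hβE, hγE, ← Module.End.mul_apply, hc,
      Module.End.mul_apply]
  set N : ℕ := finrank K V with hNdef
  let bV := Module.finBasis K V
  let toMat : Module.End K V ≃ₐ[K] Matrix (Fin N) (Fin N) K := LinearMap.toMatrixAlgEquiv bV
  let βM : B →ₐ[K] Matrix (Fin N) (Fin N) K := toMat.toAlgHom.comp βE
  let γM : D.C →ₐ[K] Matrix (Fin N) (Fin N) K := toMat.toAlgHom.comp γE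
  have hcomm : ∀ b c, βM b * γM c = γM c * βM b := fun b c => by
    change toMat (βE b) * toMat (γE c) = toMat (γE c) * toMat (βE b)
    rw [← map_mul, hcommE, map_mul]
  -- the double-centralizer count in `End_ℚ(V)`, read over `K`
  haveI : IsSimpleRing (Module.End ℚ V) := isSimpleRing_moduleEnd
  have hQ : finrank ℚ B * finrank ℚ D.C = finrank ℚ V * finrank ℚ V := by
    rw [← Module.finrank_linearMap (R := ℚ) (S := ℚ) (M := V) (N := V)]
    exact finrank_mul_finrank_centralizer_range D.ρ
  have hdim : finrank K B * finrank K D.C = N * N := by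
    apply Nat.eq_of_mul_eq_mul_left (Nat.mul_pos hK0 hK0)
    have hV : finrank ℚ V = finrank ℚ K * N := (Module.finrank_mul_finrank ℚ K V).symm
    have hC : finrank ℚ D.C = finrank ℚ K * finrank K D.C := (Module.finrank_mul_finrank ℚ K D.C).symm
    rw [htowerB, hC, hV] at hQ
    calc finrank ℚ K * finrank ℚ K * (finrank K B * finrank K ↥D.C)
        = finrank ℚ K * finrank K B * (finrank ℚ K * finrank K ↥D.C) := by ring
      _ = finrank ℚ K * N * (finrank ℚ K * N) := hQ
      _ = finrank ℚ K * finrank ℚ K * (N * N) := by ring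
  /- §7 every real place: `C_σ ≅ M_a(ℝ)`, `a² = [C:K]`, with a real model -/
  have place : ∀ σ : K →+* ℝ, ∃ a : ℕ, a ≠ 0 ∧ finrank K D.C = a * a ∧
      ∃ j : D.C →ₐ[ℚ] Matrix (Fin a) (Fin a) ℝ, IsRealModel K σ j := fun σ => by
    letI : Algebra K ℝ := σ.toAlgebra
    exact exists_realModel_real_of_orthogonalType hpos ιK hιK hdK hd0.ne' hs βM γM hcomm hdim
  obtain ⟨w₀⟩ := (inferInstance : Nonempty (InfinitePlace K))
  obtain ⟨a, ha0, hCa, -⟩ := place (w₀.embedding_of_isReal (IsTotallyReal.isReal w₀))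
  have hmodels : ∀ w : InfinitePlace K, ∃ j : D.C →ₐ[ℚ] Matrix (Fin a) (Fin a) ℝ,
      IsRealModel K (w.embedding_of_isReal (IsTotallyReal.isReal w)) j := fun w => by
    obtain ⟨b, -, hCb, j, hj⟩ := place (w.embedding_of_isReal (IsTotallyReal.isReal w))
    have hba : b = a := Nat.mul_self_inj.mp (hCb.symm.trans hCa)
    subst hba
    exact ⟨j, hj⟩
  choose j hj using hmodels
  obtain ⟨Φ, -⟩ := exists_algEquiv_pi_of_realModels (K := K) (F := D.C) (A := Matrix (Fin a) (Fin a) ℝ) hj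
  /- §8 `a` is even: `h(i) ∈ End_{B_ℝ}(V_ℝ) = ℝ ⊗_ℚ End_B(V) ≅ ℝ ⊗_ℚ C` (Lam (7.4)) has square `−1` -/
  letI : Module B V := Module.compHom V (D.ρ : B →ₐ[ℚ] Module.End ℚ V).toRingHom
  have hsmulB : ∀ (b : B) (x : V), b • x = D.ρ b x := fun _ _ => rfl
  haveI : IsScalarTower ℚ B V := ⟨fun q b x => by rw [hsmulB, hsmulB, map_smul, LinearMap.smul_apply]⟩
  have hρlin : ∀ b : B, DistribSMul.toLinearMap ℚ V b = D.ρ b := fun b => LinearMap.ext fun x => rfl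
  -- `End_B(V) ≅ C` as `ℚ`-algebras
  let eC : Module.End B V ≃ₐ[ℚ] D.C :=
    { toFun := fun f => ⟨f.restrictScalars ℚ, (Subalgebra.mem_centralizer_iff ℚ).2 (by
          rintro _ ⟨b, rfl⟩
          apply LinearMap.ext
          intro x
          change D.ρ b (f x) = f (D.ρ b x)
          rw [← hsmulB, ← hsmulB, map_smul])⟩
      invFun := fun c =>
        { toFun := fun x => (c : Module.End ℚ V) x
          map_add' := fun x y => map_add _ x y
          map_smul' := fun b x => by
            have hc := (Subalgebra.mem_centralizer_iff ℚ).1 c.2 (D.ρ b) ⟨_, rfl⟩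
            rw [RingHom.id_apply, hsmulB, hsmulB, ← Module.End.mul_apply, ← hc, Module.End.mul_apply] }
      left_inv := fun f => LinearMap.ext fun x => rfl
      right_inv := fun c => Subtype.ext (LinearMap.ext fun x => rfl)
      map_mul' := fun f g => Subtype.ext (LinearMap.ext fun x => rfl)
      map_add' := fun f g => Subtype.ext (LinearMap.ext fun x => rfl)
      commutes' := fun q => Subtype.ext (LinearMap.ext fun x => by
        change (algebraMap ℚ (Module.End B V) q) x = ((algebraMap ℚ D.C q : D.C) : Module.End ℚ V) x
        rw [Module.algebraMap_end_apply, Subalgebra.coe_algebraMap, Module.algebraMap_end_apply]) }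
  -- `h(i)` lies in `End_{B_ℝ}(V_ℝ)`
  set J : Module.End ℝ (ℝ ⊗[ℚ] V) := D.h Complex.I with hJdef
  have hJsq : J * J = -1 := by
    rw [hJdef, ← map_mul, Complex.I_mul_I, map_neg, map_one]
  have hJmem : J ∈ Literature.Algebra.Module.NoetherDeuring.endBaseChange ℚ ℝ B V := by
    rw [Literature.Algebra.Module.NoetherDeuring.mem_endBaseChange_iff,
      Literature.Algebra.Module.NoetherDeuring.mem_homBaseChange_iff]
    intro b x
    rw [hρlin]
    exact (LinearMap.congr_fun (D.h_comm Complex.I b) x)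
  obtain ⟨x, hx⟩ : ∃ x : ℝ ⊗[ℚ] D.C, x * x = -1 := by
    let θ := Literature.Algebra.Module.NoetherDeuring.thetaAlgEquiv ℚ ℝ B V
    let Jc : Literature.Algebra.Module.NoetherDeuring.endBaseChange ℚ ℝ B V := ⟨J, hJmem⟩
    have hJc : Jc * Jc + 1 = 0 := Subtype.ext (by
      rw [Subalgebra.coe_add, Subalgebra.coe_mul, Subalgebra.coe_one, Subalgebra.coe_zero]
      change J * J + 1 = 0
      rw [hJsq, neg_add_cancel])
    let T : ℝ ⊗[ℚ] Module.End B V ≃ₐ[ℝ] ℝ ⊗[ℚ] D.C := Algebra.TensorProduct.congr (AlgEquiv.refl : ℝ ≃ₐ[ℝ] ℝ) eC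
    refine ⟨T (θ.symm Jc), ?_⟩
    have h := congrArg (fun z => T (θ.symm z)) hJc
    simp only [map_add, map_mul, map_one, map_zero] at h
    exact eq_neg_of_add_eq_zero_left h
  have haeven : Even a := by
    have h1 : Φ x w₀ * Φ x w₀ = -1 := by
      rw [← Pi.mul_apply, ← map_mul, hx, map_neg, map_one]; rfl
    have h2 := even_finrank_of_mul_self_eq_neg_one h1
    rw [Module.finrank_matrix, Fintype.card_fin, Module.finrank_self, mul_one, Nat.even_mul] at h2
    exact h2.elim id id
  obtain ⟨n, hn⟩ := haeven
  have han : a = 2 * n := by rw [hn]; ring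
  have hn0 : n ≠ 0 := by rintro rfl; exact ha0 (by rw [han])
  /- §9 reindex by `Fin [F₀ : ℚ]` and `Fin a = Fin (2n)` -/
  have hF0 : finrank ℚ (F0 B) = finrank ℚ Z := by
    have hF : F0 B = Subalgebra.toSubmodule Z := by
      change Subalgebra.toSubmodule (Subalgebra.center ℚ B) ⊓ selfAdjoint.submodule ℚ B = Subalgebra.toSubmodule Z
      exact inf_eq_left.mpr fun x hx => (selfAdjoint.mem_iff (x := x)).mpr (hfix x hx)
    rw [hF, Subalgebra.finrank_toSubmodule]
  have hcard : Fintype.card (InfinitePlace K) = finrank ℚ (F0 B) := by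
    rw [hF0, ← hKZ, IsTotallyReal.finrank (K := K), InfinitePlace.card_eq_nrRealPlaces_add_nrComplexPlaces,
      IsTotallyReal.nrComplexPlaces_eq_zero, add_zero]
  let ε : InfinitePlace K ≃ Fin (finrank ℚ (F0 B)) := Fintype.equivFinOfCardEq hcard
  have hdimC : finrank ℚ D.C = (2 * n) ^ 2 * finrank ℚ (Subalgebra.center ℚ B) := by
    rw [← Module.finrank_mul_finrank ℚ K D.C, hKZ, hCa, han, ← hZdef]
    ring
  exact ⟨n, Nat.pos_of_ne_zero hn0, hdimC,
    ⟨Φ.trans ((AlgEquiv.piCongrRight fun _ => Matrix.reindexAlgEquiv ℝ ℝ (finCongr han)).trans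
      (AlgEquiv.piCongrLeft' ℝ (fun _ : InfinitePlace K => Matrix (Fin (2 * n)) (Fin (2 * n)) ℝ) ε))⟩⟩

end Literature.NumberTheory.Kottwitz1992.ModuliProblem

end
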